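import Literature.Probability.LatticeModels.MagnetizationContinuity
import Literature.Probability.LatticeModels.LatticeGreenRiemannSum
import Literature.Probability.LatticeModels.SharpnessProofs
import Literature.Probability.LatticeModels.InfraredBound
import Literature.Probability.LatticeModels.TorusFourierProofs
import Literature.Probability.LatticeModels.IsingTransport
import Literature.Probability.LatticeModels.GriffithsMonotonicity
import HarnessLib

/-!
# `M̃_LRO(β_c) = 0` for the nearest-neighbour Ising model in `d ≥ 3` via the infrared bound

Trunk G02 (T-STATMECH), topic `Probability/LatticeModels`; namespaces `Literature.StatMech` (one
definition) and `Literature.CritIsing` (named facts and proofs). Second layer of the decomposition of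
the named fact `Literature.Probability.LatticeModels.spontaneousMagnetization_criticalBeta_eq_zero` (`Sharpness.lean`):
`MagnetizationContinuity.lean` reduces it to `Literature.Probability.LatticeModels.lroTildeSq_criticalBeta_eq_zero`
(`M̃_LRO(β_c)² = 0` for `d ≥ 3`, ADS15 Cor. 1.5 (1)) plus ADS15 Thm. 1.2; this file proves
`lroTildeSq_criticalBeta_eq_zero` from the inputs of

* M. Aizenman, H. Duminil-Copin, V. Sidoravicius, *Random currents and continuity of Ising
  model's spontaneous magnetization*, Comm. Math. Phys. **334** (2015) 719–742, **§3.3**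
  ("Proof of Corollary 1.4"), eqs. (3.13)–(3.19) of arXiv:1311.1937v3 (bib key
  `AizenmanDuminilCopinSidoraviciusCMP2015`; "ADS15"; **all equation numbers in this file are those of
  arXiv v3, the version held in the literature store; the journal numbering differs**),

specialised to the nearest-neighbour model on `ℤ^d`, following the printed argument verbatim:
Gaussian domination on the torus (proved here from the tree's infrared bound), `G_L → G`
(proved: `LatticeGreenRiemannSum.lean`), `|Λ_N|⁻² ∑ G → 0` (proved: `LatticeGreenFunction.lean`),
the vanishing of the zero mode below `β_c` (named fact), left-continuity of the free state at
`β_c` (proved here from GKS II) and Griffiths' comparison of the free box with the torus (proved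
here from GKS II).

## Contents

Definition (`Literature.StatMech`): `torusZeroMode d L β = L^{-d} F̂_{L,β}(0) = L^{-d} ∑_x ⟨σ_0σ_x⟩_{𝕋_L,β}`.

Named facts (`Literature.CritIsing`, `def … : Prop`, cited; nearest-neighbour Ising model), all of them
statements printed in or directly used by ADS15 §3.3:

* `ads_gaussianDomination` — ADS15 (3.13): `x`-space Gaussian domination on the torus
  `(ℤ/Lℤ)^d`, `L` even, `L ≠ 2`, `β > 0`, real test functions, with the finite-volume Green
  function `torusGreen = 2 G_L` (`LatticeGreenFunction.lean`) and hence the constant of the tree's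
  `Literature.Probability.LatticeModels.infraredBound` (ADS15's printed constant corrected by the factor `2`, see below);
  **proved** from `infraredBound`: `ads_gaussianDomination_of_infraredBound`;
* `ads_torusZeroMode_tendsto` — ADS15 (3.17): `limsup_L L^{-d} F̂_{L,β}(0) ≤ 0` for
  `0 < β < β_c`, `d ≥ 2` (Aizenman–Barsky–Fernández 1987 finiteness of `χ` below `β_c`); the
  only input of this file not reduced to classical tree facts;
* `ads_freePair_leftContinuous` — ADS15 §3.3, arXiv v3 eq. (3.18): left-continuity of
  `β ↦ ⟨σ_xσ_y⟩^∅_β` at `β_c`, `d ≥ 2`; **proved** from GKS II, the existence of the free state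
  and `β_c > 0`: `ads_freePair_leftContinuous_of_gks` (via `GriffithsMonotonicity.lean`);
* `isingTwoPoint_free_box_le_torus` — Griffiths' second inequality in the form
  "`⟨σ_xσ_y⟩⁰_{Λ,β} ≤ ⟨σ_xσ_y⟩_{𝕋_L,β}`" used in ADS15 (3.19) (Friedli–Velenik 2017,
  Exercise 3.31 with Exercise 3.30), for boxes `Λ_n` embedded in the torus as induced subgraphs
  (`2n + 1 < L`); **proved** from GKS II on the torus graphs:
  `isingTwoPoint_free_box_le_torus_of_gks'` (via `IsingTransport.lean` and
  `GriffithsMonotonicity.lean`).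

Proved (`Literature.CritIsing`):

* `freePair_nonneg_of_gks` — `0 ≤ ⟨σ_xσ_y⟩^∅_β` from the tree facts `gks_one` and
  `hasBoxLimit_isingCorr_free` (Griffiths' first inequality in the limit);
* `ads_gaussianDomination_of_infraredBound` — **(3.13) from the infrared bound** by finite
  Fourier analysis on `(ℤ/Lℤ)^d` (`TorusFourierProofs.lean`: inversion, character expansion of
  quadratic forms) and translation invariance of the periodic two-point function
  (`IsingTransport.lean`);
* `ads_freePair_leftContinuous_of_gks` — **(3.18) from GKS II**;
* `torusGraph_adj_proj_iff`, `torusProj_injOn_box`, `isingTwoPoint_free_box_le_torus_of_gks` —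
  the box `Λ_M` embeds in `(ℤ/Lℤ)^d` as an induced subgraph for `2M + 1 < L`, and **Griffiths'
  comparison from GKS II** (transport along the embedding, then volume monotonicity inside the
  torus);
* `torus_blockSum_le` — (3.13) applied to the push-forward of `1_{Λ_n}` to the torus;
* `blockSum_freePair_le_of_lt_criticalBeta`, `blockSum_freePair_criticalBeta_le` — ADS15 (3.19)
  below and at `β_c`;
* `lroTildeSq_criticalBeta_eq_zero_of_facts` — `M̃_LRO(β_c)² = 0` for `d ≥ 3` from the four
  named facts above, `criticalBeta_pos`, `gks_one`, `hasBoxLimit_isingCorr_free` and the theorems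
  `torusGreen_tendsto_latticeGreen` ((3.15), `LatticeGreenRiemannSum.lean`) and
  `tendsto_latticeGreen_blockAverage` ((3.16), `LatticeGreenFunction.lean`);
* `lroTildeSq_criticalBeta_eq_zero_of_classical` — the same with (3.13), (3.18) and Griffiths'
  comparison discharged: **`M̃_LRO(β_c)² = 0` from `infraredBound`, `gks_two`, `gks_one`,
  `hasBoxLimit_isingCorr_free`, `criticalBeta_pos` and (3.17)**;
* `spontaneousMagnetization_criticalBeta_eq_zero_of_classical` — the **target fact
  `spontaneousMagnetization_criticalBeta_eq_zero`** (`m*(β_c) = 0`, `d ≥ 3`) from the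
  random-current identity of ADS15 §3.2 (`plusPair_eq_freePair_of_lroTildeSq`), (3.17), and the
  classical tree facts (FKG, GKS I/II, infrared bound, existence of the plus/free states,
  `β_c > 0`).

## Design and faithfulness notes

* Constants. ADS15 print Prop. 1.3 as `F̂_{L,β}(p) ≤ 1/(2β E(p))` with
  `E(p) = ∑_x (1 - cos p·x) J_{0,x}`, which for nearest-neighbour couplings is `2 ∑ᵢ (1 - cos pᵢ)`;
  the tree's `infraredBound` (Fröhlich–Simon–Spencer 1976; Friedli–Velenik 2017, Thm. 10.24) is
  `Ĝ_L(p) ≤ 1/(2β ∑ᵢ (1 - cos pᵢ))`, larger by a factor `2`, and is the correct one (for `d = 1`,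
  `Ĝ(π) = e^{-2β}` exceeds `1/(8β)` at `β = 1/2`). We vendor (3.13) with the tree's constant, i.e.
  with `torusGreen` built on `ε(p) = ∑ᵢ (1 - cos pᵢ)`; for `M̃_LRO(β_c) = 0` the constant is
  immaterial. With this constant (3.13) is *equivalent* to `infraredBound` by Fourier inversion,
  and the implication we need is proved.
* Torus sizes. `infraredBound` needs `L` even and `L ≠ 2`, so `ads_gaussianDomination` carries
  the same hypotheses; the limit (3.17) is vendored in `ε`–`L₀` form over all `L ≥ L₀`
  (`[NeZero L]`, so that `(ℤ/Lℤ)^d` is finite), which avoids sequences of dependent types; the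
  assembly picks one large even `L` ((3.15) is proved along even `L`).
* ADS15's schematic "`⟨σ_xσ_y⟩⁰_{Λ_L,β} ≤ ⟨σ_xσ_y⟩_{𝕋_L,β}`" compares a box with a torus of
  unrelated size; the precise statement vendored (`isingTwoPoint_free_box_le_torus`) embeds
  `Λ_n = [-n,n]^d` in `(ℤ/Lℤ)^d` for `2n + 1 < L` via `Torus.proj` (then the image is an induced
  subgraph: no wrap-around bond joins two image points, `torusGraph_adj_proj_iff`).
* (3.17) is vendored one-sided (`limsup ≤ 0`, all that (3.19) uses); ADS15 also note `0 ≤` (GKS).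
* Left-continuity is stated for the prelude's free state `freePair d β x y` (a `limUnder`, equal
  to the limit `lim_L ⟨σ_xσ_y⟩⁰_{Λ_L,β}` for `β ≥ 0` by `hasBoxLimit_isingCorr_free`), along
  `𝓝[<] β_c`; `2 ≤ d` guarantees `β_c > 0` (`criticalBeta_pos`).
* GKS II enters through the tree fact `gks_two` quantified over all finite-volume models on
  locally finite graphs (on `ℤ^d` for (3.18), on `(ℤ/Lℤ)^d` and its subgraphs for the torus
  comparison); `lroTildeSq_criticalBeta_eq_zero_of_classical` takes it once, for all vertex
  types in `Type`.

## What remains for `lroTildeSq_criticalBeta_eq_zero_holds`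

Given the classical tree facts, only `ads_torusZeroMode_tendsto` ((3.17)): it combines the
GHS/GKS comparison of the torus with the plus box, the vanishing of `m*` below `β_c` and the
finiteness of the susceptibility (Aizenman–Barsky–Fernández 1987), or alternatively a
finite-volume Simon–Lieb/Duminil-Copin–Tassion argument on the torus.

## Mathlib status

No Ising model / infrared bound in Mathlib. Anchors: `Filter.Tendsto`, `nhdsWithin`,
`le_of_tendsto_of_tendsto`, `ge_of_tendsto'`, `Finset.eventually_all_finset`, `Real.sInf` API,
`SimpleGraph.comap`, `Function.Embedding.subtype`, `ZMod.intCast_zmod_eq_zero_iff_dvd`.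
-/


noncomputable section

open MeasureTheory Filter Topology Finset Literature.Probability.LatticeModels Literature.Probability.Percolation

namespace Literature.Probability.LatticeModels

variable (d : ℕ)

/-- The torus zero mode `L^{-d} F̂_{L,β}(0) = L^{-d} ∑_{x ∈ 𝕋_L} ⟨σ_0 σ_x⟩_{𝕋_L,β}` of the
nearest-neighbour Ising model on `(ℤ/Lℤ)^d` at zero field (ADS15 (3.13), (3.17)). [cite: AizenmanDuminilCopinSidoraviciusCMP2015, eqs. (3.13) and (3.17)] -/
def torusZeroMode (L : ℕ) [NeZero L] (β : ℝ) : ℝ :=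
  (∑ x : TorusSite d L, isingTorusTwoPoint d L β 0 0 x) / ((L : ℝ) ^ d)

end Literature.Probability.LatticeModels

namespace Literature.Probability.LatticeModels

variable {d : ℕ}

/-- **ADS15 eq. (3.13)** (Gaussian domination in `x`-space; Aizenman–Duminil-Copin–Sidoravicius,
CMP 334 (2015), §3.3, eq. (3.13), equivalent form of the infrared bound Prop. 1.3 =
Fröhlich–Simon–Spencer, CMP 50 (1976), Thm. 3.1), nearest-neighbour Ising model on the torus
`𝕋_L = (ℤ/Lℤ)^d` at zero field: for every real `v : 𝕋_L → ℝ`,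
`∑_{x,y} v_x v_y ⟨σ_xσ_y⟩_{𝕋_L,β} ≤ (2β)⁻¹ ∑_{x,y} v_x v_y G̃_L(x - y) + L^{-d} F̂_{L,β}(0) (∑_x v_x)²`
with `G̃_L = torusGreen = 2 G_L` (`LatticeGreenFunction.lean`; ADS15's `G_L` is (3.14) with their
`E(p) = 2 ∑ᵢ (1 - cos pᵢ)`, (1.17)). Constant: this is ADS15's display (3.13) with `G_L` replaced
by `2 G_L`, i.e. the constant of the tree's `infraredBound` (`Ĝ_L(p) ≤ 1/(2β ∑ᵢ(1 - cos pᵢ))`,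
Fröhlich–Simon–Spencer 1976; Friedli–Velenik 2017, Thm. 10.24); ADS15's printed constant
`1/(2βE(p))` is smaller by a factor `2` and fails already for `d = 1`, `L → ∞`
(`Ĝ(π) = e^{-2β} > 1/(8β)` at `β = 1/2`), so we vendor the corrected form (the discrepancy is
immaterial for `M̃_LRO(β_c) = 0`). Hypotheses as in `infraredBound`: `L` even, `L ≠ 2`, `0 < β`.
Proved below from `infraredBound` (`ads_gaussianDomination_of_infraredBound`). [cite: AizenmanDuminilCopinSidoraviciusCMP2015, §3.3, eq. (3.13)] -/
def ads_gaussianDomination : Prop :=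
  ∀ (L : ℕ) [NeZero L], Even L → L ≠ 2 → ∀ ⦃β : ℝ⦄, 0 < β → ∀ v : TorusSite d L → ℝ,
    ∑ x, ∑ y, v x * v y * isingTorusTwoPoint d L β 0 x y ≤
      (∑ x, ∑ y, v x * v y * torusGreen (x - y)) / (2 * β) +
        torusZeroMode d L β * (∑ x, v x) ^ 2

/-- **ADS15 eq. (3.17)** (Aizenman–Duminil-Copin–Sidoravicius, CMP 334 (2015), §3.3, (3.17):
for `β < β_c` the zero-momentum term of (3.13) vanishes in the limit,
`0 ≤ lim_L L^{-d} F̂_{L,β}(0) ≤ lim_L |Λ_L|⁻¹ ∑_{x ∈ Λ_L} ⟨σ_0σ_x⟩⁺_{Λ_L,β} = 0`, "where use is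
made of the fact that `∑_x ⟨σ_0σ_x⟩⁺_β < ∞` for any `β < β_c`", Aizenman–Barsky–Fernández,
J. Stat. Phys. 47 (1987)), nearest-neighbour model on `ℤ^d`, `d ≥ 2`, `0 < β < β_c`:
`limsup_L L^{-d} ∑_{x ∈ 𝕋_L} ⟨σ_0σ_x⟩_{𝕋_L,β} ≤ 0`, in `ε`-form. [cite: AizenmanDuminilCopinSidoraviciusCMP2015, §3.3, eq. (3.17)] -/
def ads_torusZeroMode_tendsto : Prop :=
  2 ≤ d → ∀ ⦃β : ℝ⦄, 0 < β → β < criticalBeta d → ∀ ε > 0, ∃ L₀ : ℕ, ∀ (L : ℕ) [NeZero L],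
    L₀ ≤ L → torusZeroMode d L β ≤ ε

/-- **ADS15 §3.3, left-continuity of the free state** (Aizenman–Duminil-Copin–Sidoravicius,
CMP 334 (2015), arXiv v3 eq. (3.18): "by the Griffith inequality [Gri67],
`⟨σ_xσ_y⟩⁰_{Λ_L,β}` are monotone increasing functions of `β` and also monotone increasing in `L`.
Standard semicontinuity arguments … allow to conclude that
`⟨σ_xσ_y⟩⁰_{β_c} = lim_{β ↗ β_c} lim_{L → ∞} ⟨σ_xσ_y⟩⁰_{Λ_L,β}`"; also the semicontinuity display
in the proof of Prop. 5.1),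
nearest-neighbour model on `ℤ^d`, `d ≥ 2` (so that `β_c > 0`): `β ↦ ⟨σ_xσ_y⟩^∅_{β,0}` (the
prelude's free state `freePair`, the box limit for `β ≥ 0`) is left-continuous at `β_c`.
Proved below from GKS II and the existence of the free state
(`ads_freePair_leftContinuous_of_gks`). [cite: AizenmanDuminilCopinSidoraviciusCMP2015, §3.3, arXiv v3 eq. (3.18)] -/
def ads_freePair_leftContinuous : Prop :=
  2 ≤ d → ∀ x y : Site d,
    Tendsto (fun β : ℝ => freePair d β x y) (𝓝[<] criticalBeta d)
      (𝓝 (freePair d (criticalBeta d) x y))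

/-- **Griffiths' second inequality, free box versus torus** (Griffiths, J. Math. Phys. 8 (1967)
478/484; Kelly–Sherman 1968; Friedli–Velenik 2017, Exercise 3.31 with Exercise 3.30:
`⟨σ_A⟩_{Λ;K}` is nondecreasing in nonnegative coupling constants `K`; used in
Aizenman–Duminil-Copin–Sidoravicius, CMP 334 (2015), §3.3, proof of (3.19): "by the Griffith
inequality [Gri67], `⟨σ_xσ_y⟩⁰_{Λ_L,β} ≤ ⟨σ_xσ_y⟩_{𝕋_L,β}`"). For the nearest-neighbour Ising
model at `β ≥ 0`, zero field: if the box `Λ_n = [-n,n]^d` embeds in the torus `(ℤ/Lℤ)^d` as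
an induced subgraph (`2n + 1 < L`: no wrap-around bond joins two points of the image), then for
`x, y ∈ Λ_n` the free-boundary two-point function in `Λ_n` is at most the torus two-point
function of the images (the torus model is obtained from the embedded free box by adding
nonnegative couplings). Proved below from GKS II (`isingTwoPoint_free_box_le_torus_of_gks`). [cite: FriedliVelenik2017, Exercise 3.31 with Exercise 3.30] -/
def isingTwoPoint_free_box_le_torus : Prop :=
  ∀ ⦃β : ℝ⦄, 0 ≤ β → ∀ (n L : ℕ) [NeZero L], 2 * n + 1 < L → ∀ x ∈ box d n, ∀ y ∈ box d n,
    isingTwoPoint (zdGraph d) (box d n) β 0 .free x y ≤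
      isingTorusTwoPoint d L β 0 (Torus.proj L x) (Torus.proj L y)

end Literature.Probability.LatticeModels

namespace Literature.Probability.LatticeModels

open Percolation

variable {d : ℕ}

/-! ### Auxiliary lemmas -/

/-- `Torus.proj` is additive: `(x - y) mod L = x mod L - y mod L`. [folklore] -/
theorem torusProj_sub (L : ℕ) (x y : Site d) :
    Torus.proj L (x - y) = Torus.proj L x - Torus.proj L y := by
  funext i; simp [Torus.proj]

/-- Every pair of sites lies in a common box. [folklore] -/
theorem exists_mem_box_and (x y : Site d) : ∃ M₀ : ℕ, ∀ M, M₀ ≤ M → x ∈ box d M ∧ y ∈ box d M :=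
  ⟨max (Site.supNorm x) (Site.supNorm y), fun _ hM =>
    ⟨mem_box_iff_supNorm_le.2 (le_trans (le_max_left _ _) hM),
      mem_box_iff_supNorm_le.2 (le_trans (le_max_right _ _) hM)⟩⟩

/-- For `x ≠ y` the set correlation `⟨σ_{{x,y}}⟩` is the two-point function `⟨σ_x σ_y⟩`
(Friedli–Velenik 2017, §3.6.1). [cite: FriedliVelenik2017, §3.6.1] -/
theorem isingCorr_pair {V : Type*} (G : SimpleGraph V) [DecidableEq V] [G.LocallyFinite]
    (Λ : Finset V) (β h : ℝ) (bc : BoundaryCondition V) {x y : V} (hxy : x ≠ y) :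
    isingCorr G Λ β h bc {x, y} = isingTwoPoint G Λ β h bc x y := by
  have hs : spinProduct ({x, y} : Finset V) = spinPair x y := by
    funext s; simp [spinProduct, spinPair, Finset.prod_pair hxy]
  simp only [isingCorr, isingTwoPoint, hs]

/-- **First Griffiths inequality in the infinite-volume free state**: `0 ≤ ⟨σ_x σ_y⟩^∅_{β,0}` for
`β ≥ 0`, from the finite-volume inequality `gks_one` and the existence of the free state
`hasBoxLimit_isingCorr_free` (tree facts). (Griffiths 1967; Friedli–Velenik 2017, Thm. 3.20 and
Exercise 3.16.) [cite: FriedliVelenik2017, Thm. 3.20 and Exercise 3.16] -/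
theorem freePair_nonneg_of_gks
    (hgks : ∀ (Λ A : Finset (Site d)) (β h : ℝ) (bc : BoundaryCondition (Site d)),
      gks_one (zdGraph d) (Λ := Λ) (A := A) (β := β) (h := h) (bc := bc))
    (hlim : hasBoxLimit_isingCorr_free d) {β : ℝ} (hβ : 0 ≤ β) (x y : Site d) :
    0 ≤ freePair d β x y := by
  rcases eq_or_ne x y with rfl | hxy
  · simp
  · obtain ⟨M₀, hM₀⟩ := exists_mem_box_and x y
    refine ge_of_tendsto (tendsto_isingTwoPoint_free_pair hlim hβ x y) ?_
    filter_upwards [eventually_ge_atTop M₀] with M hM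
    have hsub : ({x, y} : Finset (Site d)) ⊆ box d M := by
      intro z hz
      rcases Finset.mem_insert.1 hz with rfl | hz
      · exact (hM₀ M hM).1
      · rw [Finset.mem_singleton.1 hz]; exact (hM₀ M hM).2
    have h0 := hgks (box d M) {x, y} β 0 .free hβ le_rfl (Or.inl rfl) hsub
    rwa [isingCorr_pair _ _ _ _ _ hxy] at h0

/-- Block averages of the free state are nonnegative when the pair correlations are
(the terms of ADS15's `M̃_LRO²`, §1.3, with Griffiths' first inequality). [cite: AizenmanDuminilCopinSidoraviciusCMP2015, §1.3] -/
theorem freeBlockAverage_nonneg {β : ℝ} (h : ∀ x y : Site d, 0 ≤ freePair d β x y)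
    (B : Finset (Site d)) : 0 ≤ freeBlockAverage d β B := by
  rw [freeBlockAverage_def]
  exact div_nonneg (sum_nonneg fun x _ => sum_nonneg fun y _ => h x y) (by positivity)

/-- Push-forward of a block along a map: summing `v_{x'} v_{y'} f(x',y')` over the torus with
`v = ∑_{x ∈ B} 1[π x = ·]` is the block double sum of `f (π x) (π y)`. Elementary. [folklore] -/
theorem sum_pushforward_mul_pushforward {α τ : Type*} [Fintype τ] [DecidableEq τ]
    (B : Finset α) (π : α → τ) (f : τ → τ → ℝ) :
    ∑ x', ∑ y', (∑ x ∈ B, if π x = x' then (1 : ℝ) else 0) *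
        (∑ y ∈ B, if π y = y' then (1 : ℝ) else 0) * f x' y' =
      ∑ x ∈ B, ∑ y ∈ B, f (π x) (π y) := by
  have h1 : ∀ (g : τ → ℝ), ∑ x', (∑ x ∈ B, if π x = x' then (1 : ℝ) else 0) * g x' =
      ∑ x ∈ B, g (π x) := by
    intro g
    calc ∑ x', (∑ x ∈ B, if π x = x' then (1 : ℝ) else 0) * g x'
        = ∑ x', ∑ x ∈ B, (if π x = x' then g x' else 0) := by
          refine sum_congr rfl fun x' _ => ?_
          rw [sum_mul]
          refine sum_congr rfl fun x _ => ?_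
          split_ifs <;> simp
      _ = ∑ x ∈ B, ∑ x', (if π x = x' then g x' else 0) := sum_comm
      _ = ∑ x ∈ B, g (π x) := by
          refine sum_congr rfl fun x _ => ?_
          rw [Finset.sum_ite_eq]; simp
  calc ∑ x', ∑ y', (∑ x ∈ B, if π x = x' then (1 : ℝ) else 0) *
        (∑ y ∈ B, if π y = y' then (1 : ℝ) else 0) * f x' y'
      = ∑ x', (∑ x ∈ B, if π x = x' then (1 : ℝ) else 0) *
          ∑ y', (∑ y ∈ B, if π y = y' then (1 : ℝ) else 0) * f x' y' := by
        refine sum_congr rfl fun x' _ => ?_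
        rw [mul_sum]
        refine sum_congr rfl fun y' _ => ?_
        ring
    _ = ∑ x', (∑ x ∈ B, if π x = x' then (1 : ℝ) else 0) * ∑ y ∈ B, f x' (π y) := by
        refine sum_congr rfl fun x' _ => ?_
        rw [h1 (f x')]
    _ = ∑ x ∈ B, ∑ y ∈ B, f (π x) (π y) := h1 _

/-- The push-forward weight has total mass `|B|`. Elementary. [folklore] -/
theorem sum_pushforward {α τ : Type*} [Fintype τ] [DecidableEq τ] (B : Finset α) (π : α → τ) :
    ∑ x', (∑ x ∈ B, if π x = x' then (1 : ℝ) else 0) = #B := by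
  rw [sum_comm]
  simp


/-! ### (3.13): Gaussian domination in `x`-space, from the infrared bound -/

/-- The torus Green function is the real part of the inverse Fourier transform of the
(zero-mode-free) inverse dispersion: `torusGreen z = Re 𝓕⁻¹(k ↦ 1_{k≠0}/ε(p_k))(z)`. [folklore] -/
theorem torusGreen_eq_torusFourierInv_re (L : ℕ) [NeZero L] (z : TorusSite d L) :
    torusGreen z = (torusFourierInv (fun k : TorusSite d L =>
      if k = 0 then (0 : ℂ) else ((dispersion (latticeMomentum L k))⁻¹ : ℝ)) z).re := by
  classical
  rw [torusFourierInv_eq_sum_torusChar, torusGreen]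
  have hc : (((L : ℂ) ^ d)⁻¹) = ((((L : ℝ) ^ d)⁻¹ : ℝ) : ℂ) := by push_cast; rfl
  rw [hc, Complex.re_ofReal_mul, Complex.re_sum, div_eq_inv_mul]
  congr 1
  rw [← Finset.sum_erase_add _ _ (Finset.mem_univ (0 : TorusSite d L))]
  simp only [if_true, zero_mul, Complex.zero_re, add_zero]
  refine Finset.sum_congr rfl fun k hk => ?_
  rw [if_neg (Finset.ne_of_mem_erase hk), Complex.re_ofReal_mul, torusChar_re, div_eq_inv_mul]

/-- The zero mode in Fourier terms: `L^{-d} Re Ĝ_L(0) ‖𝓕v(0)‖² = torusZeroMode · (∑ v)²`. [folklore] -/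
theorem torusZeroMode_mul_sq (L : ℕ) [NeZero L] (β : ℝ) (v : TorusSite d L → ℝ) :
    ((L : ℝ) ^ d)⁻¹ * ((twoPointFourierTorus (isingTorusMeasure d L β 0) 0).re *
      ‖torusFourier (fun x => (v x : ℂ)) 0‖ ^ 2) = torusZeroMode d L β * (∑ x, v x) ^ 2 := by
  rw [twoPointFourierTorus_zero, torusFourier_apply_zero, Complex.re_sum, ← Complex.ofReal_sum,
    Complex.norm_real, Real.norm_eq_abs, sq_abs, torusZeroMode, div_eq_inv_mul, mul_assoc]
  congr 2

/-- **ADS15 (3.13) from the infrared bound.** Gaussian domination in `x`-space on the torus,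
`ads_gaussianDomination`, follows from the tree's momentum-space infrared bound
`Literature.Probability.LatticeModels.infraredBound` (Fröhlich–Simon–Spencer 1976, Thm. 3.1; Friedli–Velenik 2017,
Thm. 10.24) by finite Fourier analysis: writing `⟨σ_xσ_y⟩_{𝕋_L} = G_L(x - y)` (translation
invariance, `isingTorusTwoPoint_eq_torusTwoPoint`) and expanding both quadratic forms in
characters (`sum_sum_mul_torusFourierInv_re`),
`∑ v_x v_y ⟨σ_xσ_y⟩ = L^{-d} ∑_k Re Ĝ_L(k) ‖v̂(k)‖²`, the `k = 0` term is the zero-mode term and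
for `k ≠ 0`, `Re Ĝ_L(k) ≤ 1/(2β ε(p_k))` (Aizenman–Duminil-Copin–Sidoravicius, CMP 334 (2015),
§3.3, "(3.13) is an equivalent form of (1.19)"). [cite: AizenmanDuminilCopinSidoraviciusCMP2015, §3.3, eq. (3.13)] -/
theorem ads_gaussianDomination_of_infraredBound
    (hIR : ∀ (L : ℕ) [NeZero L], infraredBound (d := d) (L := L)) :
    ads_gaussianDomination (d := d) := by
  intro L _ hL hL2 β hβ v
  classical
  -- the two-point side in Fourier variables
  have hS : ∀ x y, isingTorusTwoPoint d L β 0 x y =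
      (torusFourierInv (twoPointFourierTorus (isingTorusMeasure d L β 0)) (x - y)).re := by
    intro x y
    rw [isingTorusTwoPoint_comm, isingTorusTwoPoint_eq_torusTwoPoint]
    unfold twoPointFourierTorus
    rw [torusFourier_inversion_holds, Complex.ofReal_re]
  have lhs : ∑ x, ∑ y, v x * v y * isingTorusTwoPoint d L β 0 x y = ((L : ℝ) ^ d)⁻¹ *
      ∑ k, (twoPointFourierTorus (isingTorusMeasure d L β 0) k).re *
        ‖torusFourier (fun x => (v x : ℂ)) k‖ ^ 2 := by
    simp_rw [hS]
    exact sum_sum_mul_torusFourierInv_re _ _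
  -- the Green-function side in Fourier variables
  set gε : TorusSite d L → ℂ := fun k =>
    if k = 0 then (0 : ℂ) else ((dispersion (latticeMomentum L k))⁻¹ : ℝ) with hgε
  have rhs : ∑ x, ∑ y, v x * v y * torusGreen (x - y) = ((L : ℝ) ^ d)⁻¹ *
      ∑ k, (gε k).re * ‖torusFourier (fun x => (v x : ℂ)) k‖ ^ 2 := by
    simp_rw [torusGreen_eq_torusFourierInv_re]
    exact sum_sum_mul_torusFourierInv_re _ _
  rw [lhs, rhs]
  -- split off the zero mode on both sides
  set w : TorusSite d L → ℝ := fun k => ‖torusFourier (fun x => (v x : ℂ)) k‖ ^ 2 with hw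
  have hw0 : ∀ k, 0 ≤ w k := fun k => by positivity
  have hLd : (0 : ℝ) < ((L : ℝ) ^ d)⁻¹ := by
    have : (0 : ℝ) < L := Nat.cast_pos.2 (Nat.pos_of_ne_zero (NeZero.ne L))
    positivity
  rw [← Finset.add_sum_erase _ _ (Finset.mem_univ (0 : TorusSite d L)),
    ← Finset.add_sum_erase _ (fun k => (gε k).re * w k) (Finset.mem_univ (0 : TorusSite d L))]
  have hg0 : (gε 0).re * w 0 = 0 := by simp [hgε]
  rw [hg0, zero_add, mul_add, torusZeroMode_mul_sq]
  -- compare the nonzero modes termwise using the infrared bound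
  have hterm : ∀ k ∈ (univ : Finset (TorusSite d L)).erase 0,
      (twoPointFourierTorus (isingTorusMeasure d L β 0) k).re * w k ≤
        (gε k).re * w k / (2 * β) := by
    intro k hk
    have hk0 : k ≠ 0 := Finset.ne_of_mem_erase hk
    have hIRk := hIR L hL hL2 hβ k hk0
    have hεpos : 0 < dispersion (latticeMomentum L k) :=
      lt_of_le_of_ne (dispersion_nonneg _)
        (fun h => hk0 ((dispersion_latticeMomentum_eq_zero_iff_holds k).1 h.symm))
    have hgk : (gε k).re = (dispersion (latticeMomentum L k))⁻¹ := by
      simp [hgε, hk0]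
    calc (twoPointFourierTorus (isingTorusMeasure d L β 0) k).re * w k
        ≤ (1 / (2 * β * dispersion (latticeMomentum L k))) * w k :=
          mul_le_mul_of_nonneg_right hIRk (hw0 k)
      _ = (gε k).re * w k / (2 * β) := by
          rw [hgk]
          field_simp
  have hsum := Finset.sum_le_sum hterm
  rw [← Finset.sum_div] at hsum
  have hc := mul_le_mul_of_nonneg_left hsum hLd.le
  rw [← mul_div_assoc] at hc
  linarith

/-! ### (3.18): left-continuity of the free state, from GKS II -/

/-- **ADS15 (3.18) discharged from classical inputs**: the named fact
`ads_freePair_leftContinuous` follows from GKS II for the finite-volume models on `ℤ^d`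
(`gks_two`, tree fact), the existence of the free state (`hasBoxLimit_isingCorr_free`, tree fact)
and `β_c > 0` (`criticalBeta_pos`, tree fact), by `freePair_leftContinuous_of_gks`
(`GriffithsMonotonicity.lean`: supremum of continuous nondecreasing functions) and volume
monotonicity from GKS II (`isingCorr_free_mono_volume_of_gks_two`).
(Aizenman–Duminil-Copin–Sidoravicius, CMP 334 (2015), §3.3, arXiv v3 eq. (3.18).) [cite: AizenmanDuminilCopinSidoraviciusCMP2015, §3.3, arXiv v3 eq. (3.18)] -/
theorem ads_freePair_leftContinuous_of_gks
    (hgks : ∀ (G' : SimpleGraph (Site d)) [G'.LocallyFinite] (Λ A B : Finset (Site d)) (β h : ℝ)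
      (bc : BoundaryCondition (Site d)),
      gks_two G' (Λ := Λ) (A := A) (B := B) (β := β) (h := h) (bc := bc))
    (hlim : hasBoxLimit_isingCorr_free d) (hβc : criticalBeta_pos (d := d)) :
    ads_freePair_leftContinuous (d := d) := fun hd x y =>
  freePair_leftContinuous_of_gks (fun Λ A B β h bc => hgks (zdGraph d) Λ A B β h bc)
    (isingCorr_free_mono_volume_of_gks_two hgks) hlim (hβc hd) x y

/-! ### Embedding a box of `ℤ^d` into a large torus -/

/-- A lattice vector with all coordinates of absolute value `< L` projects to `0` in
`(ℤ/Lℤ)^d` only if it is `0`. [folklore] -/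
theorem torusProj_eq_zero_iff_of_abs_lt {L : ℕ} {v : Site d} (hv : ∀ j, |v j| < L) :
    Torus.proj L v = 0 ↔ v = 0 := by
  constructor
  · intro h
    funext j
    have hj : (v j : ZMod L) = 0 := by simpa using congrFun h j
    rw [ZMod.intCast_zmod_eq_zero_iff_dvd] at hj
    exact Int.eq_zero_of_abs_lt_dvd hj (hv j)
  · rintro rfl
    funext j
    simp

/-- `Torus.proj` of a unit vector is the unit vector. [folklore] -/
theorem torusProj_single (L : ℕ) (i : Fin d) :
    Torus.proj L (Pi.single i 1 : Site d) = Pi.single i 1 := by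
  funext j
  rw [Torus.proj_apply]
  rcases eq_or_ne j i with rfl | hj
  · simp
  · simp [Pi.single_eq_of_ne hj]

/-- `Torus.proj` is additive. [folklore] -/
theorem torusProj_add (L : ℕ) (x y : Site d) :
    Torus.proj L (x + y) = Torus.proj L x + Torus.proj L y := by
  funext i; simp [Torus.proj]

/-- Coordinates of differences of points of `Λ_M` are at most `2M` in absolute value. [folklore] -/
theorem abs_sub_le_of_mem_box {M : ℕ} {x y : Site d} (hx : x ∈ box d M) (hy : y ∈ box d M)
    (j : Fin d) : |x j - y j| ≤ 2 * M := by
  rw [mem_box] at hx hy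
  rw [abs_le]
  constructor <;> linarith [(hx j).1, (hx j).2, (hy j).1, (hy j).2]

/-- **`Torus.proj` is injective on `Λ_M` when `2M < L`.** [folklore] -/
theorem torusProj_injOn_box {M L : ℕ} (hML : 2 * M < L) {x y : Site d} (hx : x ∈ box d M)
    (hy : y ∈ box d M) (h : Torus.proj L x = Torus.proj L y) : x = y := by
  have h0 : Torus.proj L (x - y) = 0 := by rw [torusProj_sub, h, sub_self]
  have := (torusProj_eq_zero_iff_of_abs_lt (L := L) (v := x - y) fun j => ?_).1 h0
  · exact sub_eq_zero.1 this
  · rw [Pi.sub_apply]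
    exact lt_of_le_of_lt (abs_sub_le_of_mem_box hx hy j) (by exact_mod_cast hML)

/-- **The projection `Λ_M → (ℤ/Lℤ)^d` preserves and reflects nearest-neighbour adjacency when
`2M + 1 < L`** (no wrap-around bonds are seen by the box). [folklore] -/
theorem torusGraph_adj_proj_iff {M L : ℕ} (hML : 2 * M + 1 < L) {x y : Site d}
    (hx : x ∈ box d M) (hy : y ∈ box d M) :
    (torusGraph d L).Adj (Torus.proj L x) (Torus.proj L y) ↔ (zdGraph d).Adj x y := by
  -- the key step: `proj y = proj x + eᵢ ↔ y = x + eᵢ` for `x, y ∈ Λ_M`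
  have key : ∀ {x y : Site d}, x ∈ box d M → y ∈ box d M → ∀ i : Fin d,
      (Torus.proj L y = Torus.proj L x + Pi.single i 1 ↔ y = x + Pi.single i 1) := by
    intro x y hx hy i
    have hbound : ∀ j, |(y - x - Pi.single i 1 : Site d) j| < L := fun j => by
      have h1 := abs_sub_le_of_mem_box hy hx j
      have h2 : |(Pi.single i (1 : ℤ) : Site d) j| ≤ 1 := by
        rcases eq_or_ne j i with rfl | hj
        · simp
        · simp [Pi.single_eq_of_ne hj]
      calc |(y - x - Pi.single i 1 : Site d) j| = |(y j - x j) - (Pi.single i (1 : ℤ) : Site d) j| := by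
            simp [Pi.sub_apply]
        _ ≤ |y j - x j| + |(Pi.single i (1 : ℤ) : Site d) j| := abs_sub _ _
        _ < L := by
            have : (2 * M + 1 : ℤ) < L := by exact_mod_cast hML
            linarith
    have hrew : Torus.proj L y = Torus.proj L x + Pi.single i 1 ↔
        Torus.proj L (y - x - Pi.single i 1) = 0 := by
      rw [torusProj_sub, torusProj_sub, torusProj_single, sub_sub, sub_eq_zero]
    rw [hrew, torusProj_eq_zero_iff_of_abs_lt hbound, sub_sub, sub_eq_zero]
  rw [torusGraph_adj_iff, zdGraph_adj_iff]
  constructor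
  · rintro ⟨-, h | h⟩
    · obtain ⟨i, hi⟩ := h
      exact ⟨i, Or.inl ((key hx hy i).1 hi)⟩
    · obtain ⟨i, hi⟩ := h
      exact ⟨i, Or.inr ((key hy hx i).1 hi)⟩
  · rintro ⟨i, h | h⟩
    · refine ⟨fun hxy => ?_, Or.inl ⟨i, (key hx hy i).2 h⟩⟩
      have := torusProj_injOn_box (by omega) hx hy hxy
      subst this
      simpa using congrFun h i
    · refine ⟨fun hxy => ?_, Or.inr ⟨i, (key hy hx i).2 h⟩⟩
      have := torusProj_injOn_box (by omega) hx hy hxy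
      subst this
      simpa using congrFun h i

/-- **Griffiths' comparison of a free box with a large torus, from GKS II**
(Friedli–Velenik 2017, Exercise 3.31 with 3.30; used in Aizenman–Duminil-Copin–Sidoravicius
2015, §3.3, proof of (3.19)): for `β ≥ 0`, zero field, `x, y ∈ Λ_M` and `2M + 1 < L`,
`⟨σ_xσ_y⟩^∅_{Λ_M;β} ≤ ⟨σ_{x̄}σ_{ȳ}⟩_{𝕋_L;β}`. Proof: transport the free box to its (isomorphic)
image in the torus (`isingTwoPoint_free_map`, twice, through the box as a vertex type) and
enlarge the volume inside the torus (`isingCorr_free_mono_volume_of_gks`), granting GKS II for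
the finite-volume models on the torus. [cite: FriedliVelenik2017, Exercise 3.31] -/
theorem isingTwoPoint_free_box_le_torus_of_gks {L : ℕ} [NeZero L]
    (hgks : ∀ (G' : SimpleGraph (TorusSite d L)) [G'.LocallyFinite]
      (Λ A B : Finset (TorusSite d L)) (β h : ℝ) (bc : BoundaryCondition (TorusSite d L)),
      gks_two G' (Λ := Λ) (A := A) (B := B) (β := β) (h := h) (bc := bc))
    {β : ℝ} (hβ : 0 ≤ β) {M : ℕ} (hML : 2 * M + 1 < L) {x y : Site d}
    (hx : x ∈ box d M) (hy : y ∈ box d M) :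
    isingTwoPoint (zdGraph d) (box d M) β 0 .free x y ≤
      isingTorusTwoPoint d L β 0 (Torus.proj L x) (Torus.proj L y) := by
  classical
  rcases eq_or_ne x y with rfl | hxy
  · simp [isingTorusTwoPoint]
  -- the box as a vertex type, with the induced nearest-neighbour graph
  set S := ↥(box d M) with hS
  let ι₁ : S ↪ Site d := Function.Embedding.subtype _
  let Gs : SimpleGraph S := (zdGraph d).comap ι₁
  -- step 1: the free box on `ℤ^d` is the free model on `S`
  have h1 : isingTwoPoint (zdGraph d) (box d M) β 0 .free x y =
      isingTwoPoint Gs Finset.univ β 0 .free ⟨x, hx⟩ ⟨y, hy⟩ := by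
    have hmap : (Finset.univ : Finset S).map ι₁ = box d M := by
      rw [Finset.univ_eq_attach, Finset.attach_map_val]
    have := isingTwoPoint_free_map (G := Gs) (G' := zdGraph d) ι₁ (Λ := Finset.univ)
      (fun a _ b _ => Iff.rfl) β 0 ⟨x, hx⟩ ⟨y, hy⟩
    rw [hmap] at this
    exact this
  -- step 2: the free model on `S` is the free model on the image of the box in the torus
  let ι₂ : S ↪ TorusSite d L :=
    ⟨fun a => Torus.proj L a.1, fun a b hab =>
      Subtype.ext (torusProj_injOn_box (by omega) a.2 b.2 hab)⟩
  have hadj : ∀ a ∈ (Finset.univ : Finset S), ∀ b ∈ (Finset.univ : Finset S),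
      ((torusGraph d L).Adj (ι₂ a) (ι₂ b) ↔ Gs.Adj a b) := fun a _ b _ =>
    torusGraph_adj_proj_iff hML a.2 b.2
  have h2 : isingTwoPoint Gs Finset.univ β 0 .free ⟨x, hx⟩ ⟨y, hy⟩ =
      isingTwoPoint (torusGraph d L) (Finset.univ.map ι₂) β 0 .free
        (Torus.proj L x) (Torus.proj L y) :=
    (isingTwoPoint_free_map (G := Gs) (G' := torusGraph d L) ι₂ hadj β 0 ⟨x, hx⟩ ⟨y, hy⟩).symm
  -- step 3: enlarge the volume inside the torus
  have hxy' : Torus.proj L x ≠ Torus.proj L y := fun h =>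
    hxy (torusProj_injOn_box (by omega) hx hy h)
  have h3 : isingTwoPoint (torusGraph d L) (Finset.univ.map ι₂) β 0 .free
        (Torus.proj L x) (Torus.proj L y) ≤
      isingTorusTwoPoint d L β 0 (Torus.proj L x) (Torus.proj L y) := by
    rw [isingTorusTwoPoint, isingTwoPoint_eq_isingCorr _ _ _ _ _ hxy',
      isingTwoPoint_eq_isingCorr _ _ _ _ _ hxy']
    refine isingCorr_free_mono_volume_of_gks (torusGraph d L) hgks hβ le_rfl ?_
      (Finset.subset_univ _)
    intro z hz
    simp only [Finset.mem_insert, Finset.mem_singleton] at hz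
    rcases hz with rfl | rfl
    · exact Finset.mem_map.2 ⟨⟨x, hx⟩, Finset.mem_univ _, rfl⟩
    · exact Finset.mem_map.2 ⟨⟨y, hy⟩, Finset.mem_univ _, rfl⟩
  rw [h1, h2]
  exact h3

/-- **The named fact `isingTwoPoint_free_box_le_torus` from GKS II** on the torus graphs. [cite: FriedliVelenik2017, Exercise 3.31] -/
theorem isingTwoPoint_free_box_le_torus_of_gks'
    (hgks : ∀ (L : ℕ) [NeZero L] (G' : SimpleGraph (TorusSite d L)) [G'.LocallyFinite]
      (Λ A B : Finset (TorusSite d L)) (β h : ℝ) (bc : BoundaryCondition (TorusSite d L)),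
      gks_two G' (Λ := Λ) (A := A) (B := B) (β := β) (h := h) (bc := bc)) :
    isingTwoPoint_free_box_le_torus (d := d) :=
  fun _ hβ _ L _ hnL _ hx _ hy => isingTwoPoint_free_box_le_torus_of_gks (hgks L) hβ hnL hx hy

/-! ### The torus bound for a block (ADS15 (3.13) applied to `v = 1_{Λ_n}`) -/

/-- ADS15 (3.13) for the push-forward of the indicator of a block `Λ_n ⊂ ℤ^d` to the torus:
`∑_{x,y ∈ Λ_n} ⟨σ_{x̄}σ_{ȳ}⟩_{𝕋_L,β} ≤ (2β)⁻¹ ∑_{x,y ∈ Λ_n} G_L(x̄ - ȳ) + L^{-d} F̂_L(0) |Λ_n|²`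
(`x̄ = x mod L`). (Aizenman–Duminil-Copin–Sidoravicius, CMP 334 (2015), §3.3, (3.13) with
`v_x = 1[x ∈ Λ_n]`, as used for (3.19).) [cite: AizenmanDuminilCopinSidoraviciusCMP2015, §3.3, eqs. (3.13) and (3.19)] -/
theorem torus_blockSum_le (hGD : ads_gaussianDomination (d := d)) (L : ℕ) [NeZero L]
    (hL : Even L) (hL2 : L ≠ 2) {β : ℝ} (hβ : 0 < β) (B : Finset (Site d)) :
    ∑ x ∈ B, ∑ y ∈ B, isingTorusTwoPoint d L β 0 (Torus.proj L x) (Torus.proj L y) ≤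
      (∑ x ∈ B, ∑ y ∈ B, torusGreen (Torus.proj L x - Torus.proj L y)) / (2 * β) +
        torusZeroMode d L β * (#B : ℝ) ^ 2 := by
  classical
  set v : TorusSite d L → ℝ := fun x' => ∑ x ∈ B, if Torus.proj L x = x' then (1 : ℝ) else 0
    with hv
  have h := hGD L hL hL2 hβ v
  rw [hv, sum_pushforward_mul_pushforward B (Torus.proj L) (isingTorusTwoPoint d L β 0),
    sum_pushforward_mul_pushforward B (Torus.proj L) fun x' y' => torusGreen (x' - y'),
    sum_pushforward B (Torus.proj L)] at h
  exact h


/-! ### Assembly of ADS15 §3.3 -/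

/-- **ADS15 §3.3, the bound (3.19) below `β_c`**: for `0 < β < β_c` and every block `Λ_n`,
`∑_{x,y ∈ Λ_n} ⟨σ_xσ_y⟩^∅_β ≤ (2β)⁻¹ ∑_{x,y ∈ Λ_n} G(x - y)` (tree normalisation of `G`), from the
free-state box limit, Griffiths' comparison free box `≤` torus, Gaussian domination (3.13) on a
large even torus, the convergence `G_L → G` (3.15) (theorem `torusGreen_tendsto_latticeGreen`) and
the vanishing of the zero mode (3.17).
(Aizenman–Duminil-Copin–Sidoravicius, CMP 334 (2015), §3.3, second line of (3.19).) [cite: AizenmanDuminilCopinSidoraviciusCMP2015, §3.3, eq. (3.19)] -/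
theorem blockSum_freePair_le_of_lt_criticalBeta
    (hGD : ads_gaussianDomination (d := d))
    (hZ : ads_torusZeroMode_tendsto (d := d)) (hBT : isingTwoPoint_free_box_le_torus (d := d))
    (hlim : hasBoxLimit_isingCorr_free d) (hd : 3 ≤ d) (n : ℕ) {β : ℝ} (hβ : 0 < β)
    (hβc : β < criticalBeta d) :
    ∑ x ∈ box d n, ∑ y ∈ box d n, freePair d β x y ≤
      (∑ x ∈ box d n, ∑ y ∈ box d n, latticeGreen (x - y)) / (2 * β) := by
  have hd2 : 2 ≤ d := le_trans (by norm_num) hd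
  set B := box d n with hB
  set S := ∑ x ∈ B, ∑ y ∈ B, freePair d β x y with hS
  set g := ∑ x ∈ B, ∑ y ∈ B, latticeGreen (x - y) with hg
  have hN : (0 : ℝ) < #B := by exact_mod_cast (box_nonempty d n).card_pos
  refine le_of_forall_pos_le_add fun δ hδ => ?_
  -- error budgets for the three approximations
  set ε₂ : ℝ := δ * (2 * β) / (3 * (#B : ℝ) ^ 2) with hε₂
  have hε₂_pos : 0 < ε₂ := by positivity
  set ε₃ : ℝ := δ / (3 * (#B : ℝ) ^ 2) with hε₃
  have hε₃_pos : 0 < ε₃ := by positivity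
  -- (i) finite-volume approximation of the finitely many free pair correlations
  have hfin : Tendsto (fun M : ℕ => ∑ x ∈ B, ∑ y ∈ B,
      isingTwoPoint (zdGraph d) (box d M) β 0 .free x y) atTop (𝓝 S) :=
    tendsto_finsetSum _ fun x _ => tendsto_finsetSum _ fun y _ =>
      tendsto_isingTwoPoint_free_pair hlim hβ.le x y
  obtain ⟨M, hMn, hM⟩ : ∃ M, n ≤ M ∧ S - δ / 3 < ∑ x ∈ B, ∑ y ∈ B,
      isingTwoPoint (zdGraph d) (box d M) β 0 .free x y :=
    ((eventually_ge_atTop n).and (hfin.eventually_const_lt (by linarith))).exists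
  -- (ii) convergence of `G_L` on the finitely many differences, (iii) the zero mode
  have hGL' : ∀ᶠ L : ℕ in atTop, ∀ p ∈ B ×ˢ B, ∀ [NeZero L], Even L →
      |torusGreen (Torus.proj L (p.1 - p.2)) - latticeGreen (p.1 - p.2)| ≤ ε₂ := by
    refine (eventually_all_finset (B ×ˢ B)).2 fun p _ => ?_
    obtain ⟨L₀, hL₀⟩ := torusGreen_tendsto_latticeGreen d hd (p.1 - p.2) hε₂_pos
    exact eventually_atTop.2 ⟨L₀, fun L hL _ hLe => hL₀ L hLe hL⟩
  have hZ' : ∀ᶠ L : ℕ in atTop, ∀ [NeZero L], torusZeroMode d L β ≤ ε₃ := by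
    obtain ⟨L₀, hL₀⟩ := hZ hd2 hβ hβc ε₃ hε₃_pos
    exact eventually_atTop.2 ⟨L₀, fun L hL _ => hL₀ L hL⟩
  obtain ⟨L₁, hL₁⟩ := eventually_atTop.1 (hGL'.and hZ')
  -- an even torus size beyond all thresholds
  obtain ⟨K, hK₁, hKM⟩ : ∃ K, L₁ ≤ K ∧ M ≤ K := ⟨max L₁ M, le_max_left _ _, le_max_right _ _⟩
  set L := 2 * K + 4 with hL
  haveI : NeZero L := ⟨by omega⟩
  have hLe : Even L := ⟨K + 2, by omega⟩
  have hL2 : L ≠ 2 := by omega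
  have hML : 2 * M + 1 < L := by omega
  obtain ⟨hGL_L, hZ_L⟩ := hL₁ L (by omega)
  -- the chain of inequalities
  have h1 : ∑ x ∈ B, ∑ y ∈ B, isingTwoPoint (zdGraph d) (box d M) β 0 .free x y ≤
      ∑ x ∈ B, ∑ y ∈ B, isingTorusTwoPoint d L β 0 (Torus.proj L x) (Torus.proj L y) :=
    sum_le_sum fun x hx => sum_le_sum fun y hy =>
      hBT hβ.le M L hML x (box_mono d hMn hx) y (box_mono d hMn hy)
  have h2 := torus_blockSum_le hGD L hLe hL2 hβ B
  have h3 : ∑ x ∈ B, ∑ y ∈ B, torusGreen (Torus.proj L x - Torus.proj L y) ≤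
      g + (#B : ℝ) ^ 2 * ε₂ := by
    have h : ∑ x ∈ B, ∑ y ∈ B, torusGreen (Torus.proj L x - Torus.proj L y) ≤
        ∑ x ∈ B, ∑ y ∈ B, (latticeGreen (x - y) + ε₂) :=
      sum_le_sum fun x hx => sum_le_sum fun y hy => by
        have h := hGL_L (x, y) (Finset.mk_mem_product hx hy) hLe
        rw [torusProj_sub] at h
        linarith [(abs_sub_le_iff.1 h).1]
    refine h.trans_eq ?_
    simp only [sum_add_distrib, sum_const, hg]
    ring
  have h4 : torusZeroMode d L β * (#B : ℝ) ^ 2 ≤ ε₃ * (#B : ℝ) ^ 2 :=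
    mul_le_mul_of_nonneg_right hZ_L (by positivity)
  have h5 : (∑ x ∈ B, ∑ y ∈ B, torusGreen (Torus.proj L x - Torus.proj L y)) / (2 * β) ≤
      (g + (#B : ℝ) ^ 2 * ε₂) / (2 * β) :=
    div_le_div_of_nonneg_right h3 (by positivity)
  have h6 : (g + (#B : ℝ) ^ 2 * ε₂) / (2 * β) + ε₃ * (#B : ℝ) ^ 2 + δ / 3 = g / (2 * β) + δ := by
    rw [hε₂, hε₃]
    field_simp
    ring
  linarith

/-- **ADS15 eq. (3.19)**: at `β_c`, for every block `Λ_n`,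
`∑_{x,y ∈ Λ_n} ⟨σ_xσ_y⟩^∅_{β_c} ≤ (2β_c)⁻¹ ∑_{x,y ∈ Λ_n} G(x - y)`, by left-continuity of the
free state and the bound below `β_c`. (Aizenman–Duminil-Copin–Sidoravicius, CMP 334 (2015),
§3.3, eq. (3.19).) [cite: AizenmanDuminilCopinSidoraviciusCMP2015, §3.3, eq. (3.19)] -/
theorem blockSum_freePair_criticalBeta_le
    (hGD : ads_gaussianDomination (d := d))
    (hZ : ads_torusZeroMode_tendsto (d := d)) (hLC : ads_freePair_leftContinuous (d := d))
    (hBT : isingTwoPoint_free_box_le_torus (d := d)) (hβc : criticalBeta_pos (d := d))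
    (hlim : hasBoxLimit_isingCorr_free d) (hd : 3 ≤ d) (n : ℕ) :
    ∑ x ∈ box d n, ∑ y ∈ box d n, freePair d (criticalBeta d) x y ≤
      (∑ x ∈ box d n, ∑ y ∈ box d n, latticeGreen (x - y)) / (2 * criticalBeta d) := by
  have hd2 : 2 ≤ d := le_trans (by norm_num) hd
  have hβc_pos : 0 < criticalBeta d := hβc hd2
  set g := ∑ x ∈ box d n, ∑ y ∈ box d n, latticeGreen (x - y) with hg
  have hS : Tendsto (fun β : ℝ => ∑ x ∈ box d n, ∑ y ∈ box d n, freePair d β x y)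
      (𝓝[<] criticalBeta d) (𝓝 (∑ x ∈ box d n, ∑ y ∈ box d n, freePair d (criticalBeta d) x y)) :=
    tendsto_finsetSum _ fun x _ => tendsto_finsetSum _ fun y _ => hLC hd2 x y
  have hg' : Tendsto (fun β : ℝ => g / (2 * β)) (𝓝[<] criticalBeta d)
      (𝓝 (g / (2 * criticalBeta d))) :=
    ((tendsto_const_nhds.div (tendsto_const_nhds.mul tendsto_id) (by positivity)).mono_left
      nhdsWithin_le_nhds)
  refine le_of_tendsto_of_tendsto hS hg' ?_
  filter_upwards [Ioo_mem_nhdsLT hβc_pos] with β hβ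
  exact blockSum_freePair_le_of_lt_criticalBeta hGD hZ hBT hlim hd n hβ.1 hβ.2

/-- **`M̃_LRO(β_c) = 0` for the nearest-neighbour Ising model on `ℤ^d`, `d ≥ 3`, from the
ADS15 §3.3 inputs** (Aizenman–Duminil-Copin–Sidoravicius, CMP 334 (2015), §3.3, last paragraph:
"Incorporating now (3.16) in (3.19), we see that if Condition (1.18) holds, then
`M̃_LRO(β_c) = 0`"): the named fact `lroTildeSq_criticalBeta_eq_zero` follows from the named facts
Gaussian domination (3.13), the zero-mode bound (3.17), left-continuity of the free state and
Griffiths' free-box/torus comparison, together with the theorems `G_L → G` (3.15)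
(`torusGreen_tendsto_latticeGreen`) and the Cesàro decay (3.16) of `G`
(`tendsto_latticeGreen_blockAverage`), `β_c > 0`, and the tree facts `gks_one` (block averages are
`≥ 0`, so the infimum defining `M̃_LRO²` (§1.3) is squeezed to `0`) and `hasBoxLimit_isingCorr_free`. [cite: AizenmanDuminilCopinSidoraviciusCMP2015, §3.3, eqs. (3.16)–(3.19)] -/
theorem lroTildeSq_criticalBeta_eq_zero_of_facts
    (hGD : ads_gaussianDomination (d := d))
    (hZ : ads_torusZeroMode_tendsto (d := d)) (hLC : ads_freePair_leftContinuous (d := d))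
    (hBT : isingTwoPoint_free_box_le_torus (d := d)) (hβc : criticalBeta_pos (d := d))
    (hgks : ∀ (Λ A : Finset (Site d)) (β h : ℝ) (bc : BoundaryCondition (Site d)),
      gks_one (zdGraph d) (Λ := Λ) (A := A) (β := β) (h := h) (bc := bc))
    (hlim : hasBoxLimit_isingCorr_free d) :
    lroTildeSq_criticalBeta_eq_zero (d := d) := by
  intro hd
  have hd2 : 2 ≤ d := le_trans (by norm_num) hd
  have hβc_pos : 0 < criticalBeta d := hβc hd2
  have hnonneg : ∀ x y : Site d, 0 ≤ freePair d (criticalBeta d) x y :=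
    freePair_nonneg_of_gks hgks hlim hβc_pos.le
  have hbdd : BddBelow (freeBlockAverage d (criticalBeta d) '' {B : Finset (Site d) | B.Nonempty}) :=
    ⟨0, by rintro _ ⟨B, -, rfl⟩; exact freeBlockAverage_nonneg hnonneg B⟩
  -- upper bound along the boxes `Λ_N`
  have hup : ∀ N : ℕ, lroTildeSq d (criticalBeta d) ≤
      (∑ x ∈ box d N, ∑ y ∈ box d N, latticeGreen (x - y)) / (#(box d N) : ℝ) ^ 2 /
        (2 * criticalBeta d) := fun N =>
    calc lroTildeSq d (criticalBeta d) ≤ freeBlockAverage d (criticalBeta d) (box d N) :=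
          lroTildeSq_le d hbdd (box_nonempty d N)
      _ ≤ (∑ x ∈ box d N, ∑ y ∈ box d N, latticeGreen (x - y)) / (2 * criticalBeta d) /
            (#(box d N) : ℝ) ^ 2 :=
          div_le_div_of_nonneg_right
            (blockSum_freePair_criticalBeta_le hGD hZ hLC hBT hβc hlim hd N) (by positivity)
      _ = _ := div_right_comm _ _ _
  have hlimit : Tendsto (fun N : ℕ =>
      (∑ x ∈ box d N, ∑ y ∈ box d N, latticeGreen (x - y)) / (#(box d N) : ℝ) ^ 2 /
        (2 * criticalBeta d)) atTop (𝓝 0) := by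
    simpa using (tendsto_latticeGreen_blockAverage d hd).div_const (2 * criticalBeta d)
  exact le_antisymm (ge_of_tendsto' hlimit hup)
    (le_lroTildeSq d fun B _ => freeBlockAverage_nonneg hnonneg B)

/-- **`M̃_LRO(β_c) = 0` (`d ≥ 3`) from classical inputs and the zero-mode bound (3.17).**
The named fact `lroTildeSq_criticalBeta_eq_zero` (ADS15 §3.3) follows from the tree's classical
named facts — the infrared bound `infraredBound` (Fröhlich–Simon–Spencer 1976), GKS II
`gks_two` (for all finite-volume models on locally finite graphs), GKS I `gks_one`, the
existence of the free state `hasBoxLimit_isingCorr_free`, `β_c > 0` (`criticalBeta_pos`) — and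
the single remaining ADS15-specific input `ads_torusZeroMode_tendsto` ((3.17), finiteness of the
susceptibility below `β_c`, Aizenman–Barsky–Fernández 1987): Gaussian domination (3.13), the
left-continuity (3.18) and Griffiths' torus comparison are theorems
(`ads_gaussianDomination_of_infraredBound`, `ads_freePair_leftContinuous_of_gks`,
`isingTwoPoint_free_box_le_torus_of_gks'`), as are (3.15) and (3.16).
(Aizenman–Duminil-Copin–Sidoravicius, CMP 334 (2015), §3.3.) [cite: AizenmanDuminilCopinSidoraviciusCMP2015, §3.3, eqs. (3.13)–(3.19)] -/
theorem lroTildeSq_criticalBeta_eq_zero_of_classical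
    (hIR : ∀ (L : ℕ) [NeZero L], infraredBound (d := d) (L := L))
    (hgks2 : ∀ (V : Type) [DecidableEq V] (G' : SimpleGraph V) [G'.LocallyFinite]
      (Λ A B : Finset V) (β h : ℝ) (bc : BoundaryCondition V),
      gks_two G' (Λ := Λ) (A := A) (B := B) (β := β) (h := h) (bc := bc))
    (hgks1 : ∀ (Λ A : Finset (Site d)) (β h : ℝ) (bc : BoundaryCondition (Site d)),
      gks_one (zdGraph d) (Λ := Λ) (A := A) (β := β) (h := h) (bc := bc))
    (hlim : hasBoxLimit_isingCorr_free d) (hβc : criticalBeta_pos (d := d))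
    (hZ : ads_torusZeroMode_tendsto (d := d)) :
    lroTildeSq_criticalBeta_eq_zero (d := d) :=
  lroTildeSq_criticalBeta_eq_zero_of_facts (ads_gaussianDomination_of_infraredBound hIR) hZ
    (ads_freePair_leftContinuous_of_gks (fun G' _ => hgks2 (Site d) G') hlim hβc)
    (isingTwoPoint_free_box_le_torus_of_gks' fun L _ G' _ => hgks2 (TorusSite d L) G') hβc hgks1
    hlim

/-- **The target fact `spontaneousMagnetization_criticalBeta_eq_zero` (crit-ising.S09,
`m*(β_c) = 0` for `d ≥ 3`) from its remaining named inputs.** What is *assumed*: the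
random-current heart of ADS15 Thm. 1.2 (`plusPair_eq_freePair_of_lroTildeSq`: Thm. 3.1,
Thm. 2.5 and (3.8)/(3.11)), the zero-mode bound (3.17) (`ads_torusZeroMode_tendsto`), and the
classical tree facts FKG (`ising_fkg`), GKS I/II (`gks_one`, `gks_two`), the infrared bound
(`infraredBound`), the existence of the plus and free states (`hasBoxLimit_isingCorr_plus`,
`hasBoxLimit_isingCorr_free`, `exists_plusMeasure`) and `β_c > 0` (`criticalBeta_pos`); what is
*proved* (this file, `MagnetizationContinuity.lean`, `LatticeGreenFunction.lean`,
`LatticeGreenRiemannSum.lean`, `GriffithsMonotonicity.lean`, `IsingTransport.lean`,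
`TorusFourierProofs.lean`): everything else in ADS15 §3.2 (averaging, FKG (3.12), translation
invariance) and §3.3 ((3.13), (3.15), (3.16), (3.18), (3.19), Griffiths' comparison).
(Aizenman–Duminil-Copin–Sidoravicius, CMP 334 (2015), Thm. 1.2 with Cor. 1.5 (1).) [cite: AizenmanDuminilCopinSidoraviciusCMP2015, Thm. 1.2 with Cor. 1.5 (1)] -/
theorem spontaneousMagnetization_criticalBeta_eq_zero_of_classical
    (h31 : plusPair_eq_freePair_of_lroTildeSq (d := d))
    (hZ : ads_torusZeroMode_tendsto (d := d))
    (hfkg : ∀ β : ℝ, ising_fkg (zdGraph d) (β := β))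
    (hlimp : hasBoxLimit_isingCorr_plus d)
    (hplus : ∀ β : ℝ, exists_plusMeasure d (β := β) 0)
    (hIR : ∀ (L : ℕ) [NeZero L], infraredBound (d := d) (L := L))
    (hgks2 : ∀ (V : Type) [DecidableEq V] (G' : SimpleGraph V) [G'.LocallyFinite]
      (Λ A B : Finset V) (β h : ℝ) (bc : BoundaryCondition V),
      gks_two G' (Λ := Λ) (A := A) (B := B) (β := β) (h := h) (bc := bc))
    (hgks1 : ∀ (Λ A : Finset (Site d)) (β h : ℝ) (bc : BoundaryCondition (Site d)),
      gks_one (zdGraph d) (Λ := Λ) (A := A) (β := β) (h := h) (bc := bc))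
    (hlim : hasBoxLimit_isingCorr_free d) (hβc : criticalBeta_pos (d := d)) :
    spontaneousMagnetization_criticalBeta_eq_zero (d := d) :=
  spontaneousMagnetization_criticalBeta_eq_zero_of_ads
    (spontaneousMagnetization_criticalBeta_eq_zero_of_lroTildeSq_of_ingredients h31
      (plusExpect_spinAt_mul_le_plusPair_of_fkg hfkg hlimp)
      (plusExpect_spinAt_eq_spontaneousMagnetization_of_exists_plusMeasure hplus))
    (lroTildeSq_criticalBeta_eq_zero_of_classical hIR hgks2 hgks1 hlim hβc hZ)

end Literature.Probability.LatticeModels
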